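import Mathlib
import Summits.NavierStokesRegularity.NavierStokesRegularity.Theorems.FilamentSkeletonRssStadiumTentNhds
import Summits.NavierStokesRegularity.NavierStokesRegularity.Theorems.FilamentSkeletonRssStadiumTentReal
import Summits.NavierStokesRegularity.NavierStokesRegularity.Theorems.FilamentSkeletonRssStadiumOwnTentBound
import Summits.NavierStokesRegularity.NavierStokesRegularity.Theorems.FilamentSkeletonRssStadiumPartnerReal
import Summits.NavierStokesRegularity.NavierStokesRegularity.Theorems.FilamentSkeletonRssStadiumCplxSum
import Summits.NavierStokesRegularity.NavierStokesRegularity.Theorems.FilamentSkeletonRssStadiumBilinearUnitSpeed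

/-!
# Route `FilamentSkeletonRss` · cruxes `SkeletonJ1L` (stmt-NavierStokesRegularity-23296, registered stub `stub_tangentSkeletonL` ≡
# `TangentSkeletonNearStraightL`, stmt-23320) · line `child_tangent_analytic_strip_L` (b0b56c52900dd90a), stub `stub_stripPropagation` —
# THE PER-FILAMENT CORE OF THE REGISTERED (quarter-width) STRIP PROPAGATION

Quarter-width analogue of `Theorems.StadiumStripCore.strip_core` (the /16 core): for ONE filament `j` at ONE value of `Γ`, with the stub's data unpacked
(`F`, `G` the stadium continuations of `X j`, `Aa j`; the other filaments real, `C¹`, unit speed, near-straight, separated by `d₀ ≥ 4hs`; cores `≥ Λ⁻¹`;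
the stub's defining equation for `u`; the plateau log-condition `√(κ/(2Λ)) ≤ √(21/25)·hs/5`), the three clauses of
`StadiumAnalyticBdd (hs/4) L (c j) B (τ ↦ u X (X j τ))` hold on the FULL quarter stadium `Q = {|Im z| < hs/4, |Re z − c j| < L + hs/4}` with the
EXPLICIT bound `B = (Σ_k |Γγ_k/4π|)·(B_tent(hs, κ, Λ) + B_partner(d₀))` (`quarter_core`): own term = the symmetric tent field
(holomorphy `Theorems.StadiumTentNhds.tent_differentiableOn`, real trace `Theorems.StadiumTentReal.tent_real`, bound
`Theorems.StadiumOwnTentBound.own_tent_norm_le`), partners = `Theorems.StadiumPartnerPiece` / `Theorems.StadiumPartnerReal`, sum = `Theorems.StadiumCplxSum`.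
What remains for `rcore` (hence the registered stub via `Theorems.StadiumStripPropagationRightHalf.stripPropagation_of_rightHalfCore`, or directly via
`Theorems.StadiumStripPropagationQuarter.stripPropagation_of_quarterCore`) is ONLY real Γ-asymptotics: `hs := cs√Γ`, `L := Rb√(Γ log Γ)`, `d₀ := ρ√Γ`,
`B_tent + B_partner ≤ A·((1 + |log(L + hs/4)| + ((L + hs/4)/(hs/4))²)/(hs/4) + 1/(ρ√Γ))` and the log-condition for `hs ≥ 4h₀`.
HONEST FRAMING: bookkeeping for a HYPOTHETICAL filament skeleton on the NEGATIVE side of a MODEL route; the stub `stub_stripPropagation` is NOT closed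
by this file, `TangentSkeletonNearStraightL` / `SkeletonJ1L` stay OPEN; nothing here bears on Navier–Stokes regularity or blow-up.
`--supports stmt-NavierStokesRegularity-23320` (≡ stub `stub_tangentSkeletonL` of 23296).
-/

set_option linter.dupNamespace false

noncomputable section

namespace Summit.NavierStokesRegularity.NavierStokesRegularity.Theorems.StadiumQuarterCore

open Set Metric MeasureTheory Complex Finset
open scoped InnerProductSpace Matrix
open Literature.Analysis.FluidPDE
open Summit.NavierStokesRegularity.NavierStokesRegularity.Theorems.StadiumTentNhds
open Summit.NavierStokesRegularity.NavierStokesRegularity.Theorems.StadiumTentReal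
open Summit.NavierStokesRegularity.NavierStokesRegularity.Theorems.StadiumOwnTentBound
open Summit.NavierStokesRegularity.NavierStokesRegularity.Theorems.StadiumPartnerPiece
open Summit.NavierStokesRegularity.NavierStokesRegularity.Theorems.StadiumPartnerReal
open Summit.NavierStokesRegularity.NavierStokesRegularity.Theorems.StadiumCplxSum

/-- **Per-filament core of the registered (quarter-width) strip propagation, on the full quarter stadium.**  See the module docstring. [folklore] -/
theorem quarter_core {N : ℕ} {hs L Rb Λ d₀ Γ : ℝ} {γ : Fin N → ℝ} {X : Fin N → ℝ → EuclideanSpace ℝ (Fin 3)} {c : Fin N → ℝ}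
    {Aa : Fin N → ℝ → ℝ} {u : (Fin N → ℝ → EuclideanSpace ℝ (Fin 3)) → EuclideanSpace ℝ (Fin 3) → EuclideanSpace ℝ (Fin 3)}
    (j : Fin N) {F : ℂ → (Fin 3 → ℂ)} {G : ℂ → ℂ}
    (hu : ∀ Z y, u Z y = ∑ k, (Γ * γ k / (4 * Real.pi)) • ∫ σ : ℝ,
      ((‖y - Z k σ‖ ^ 2 + Real.exp (-(1 + Real.eulerMascheroniConstant - Real.log 2)) * Aa k σ) ^ (3/2 : ℝ))⁻¹ • cross (deriv (Z k) σ) (y - Z k σ))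
    (hXc : ∀ k, ContDiff ℝ 2 (X k)) (hXu : ∀ k τ, ‖deriv (X k) τ‖ = 1) (hRb0 : 0 ≤ Rb) (hRb : Rb ≤ 1 / 2)
    (hosc : ∀ k τ σ, ‖deriv (X k) τ - deriv (X k) σ‖ ≤ Rb)
    (hAd : ∀ k, Differentiable ℝ (Aa k)) (hΛ : 0 < Λ) (hAfloor : ∀ k σ, Λ⁻¹ ≤ Aa k σ)
    (hd₀ : 0 < d₀) (hsep : ∀ k, k ≠ j → ∀ τ σ, d₀ ≤ ‖X j τ - X k σ‖)
    (hF : DifferentiableOn ℂ F {z : ℂ | |z.im| < hs ∧ |z.re - c j| < L + hs})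
    (hM : ∀ z ∈ {z : ℂ | |z.im| < hs ∧ |z.re - c j| < L + hs}, ‖deriv F z‖ ≤ 2)
    (hFX : ∀ r : ℝ, (r : ℂ) ∈ {z : ℂ | |z.im| < hs ∧ |z.re - c j| < L + hs} →
      F r = fun i => ((⟪X j r, EuclideanSpace.single i (1:ℝ)⟫_ℝ : ℝ) : ℂ))
    (hG : DifferentiableOn ℂ G {z : ℂ | |z.im| < hs ∧ |z.re - c j| < L + hs})
    (hGA : ∀ w ∈ {z : ℂ | |z.im| < hs ∧ |z.re - c j| < L + hs}, Aa j w.re / 2 ≤ (G w).re)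
    (hGX : ∀ r : ℝ, (r : ℂ) ∈ {z : ℂ | |z.im| < hs ∧ |z.re - c j| < L + hs} → G r = ((Aa j r : ℝ) : ℂ))
    (hhs : 0 < hs) (hL : 0 < L) (h16d : 16 * (hs / 4) ≤ d₀)
    (hR : √(Real.exp (-(1 + Real.eulerMascheroniConstant - Real.log 2)) / (2 * Λ)) / √((21 / 25 : ℝ) * (hs / 5) ^ 2) ≤ 1 - 0) :
    ∃ U : ℂ → (Fin 3 → ℂ), DifferentiableOn ℂ U {z : ℂ | |z.im| < hs / 4 ∧ |z.re - c j| < L + hs / 4} ∧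
      (∀ t : ℝ, (t : ℂ) ∈ {z : ℂ | |z.im| < hs / 4 ∧ |z.re - c j| < L + hs / 4} →
        U t = fun i => ((⟪u X (X j t), EuclideanSpace.single i (1:ℝ)⟫_ℝ : ℝ) : ℂ)) ∧
      ∀ z ∈ {z : ℂ | |z.im| < hs / 4 ∧ |z.re - c j| < L + hs / 4}, ‖U z‖ ≤ (∑ k, |Γ * γ k / (4 * Real.pi)|) *
        ((2 * (160 * (Real.pi / (1 * (hs / 2)))) + 2 * (((0.007 * hs) ^ 2) ^ (-(3/2 : ℝ)) * (8 * hs) * hs) +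
          2 * (4 * (2 * ((2 / (hs / 2)) * (hs / 5) ^ 3)) *
            ((1/3 + Real.log ((1 - 0) * √((21 / 25 : ℝ) * (hs / 5) ^ 2) /
              √(Real.exp (-(1 + Real.eulerMascheroniConstant - Real.log 2)) / (2 * Λ)))) / ((21 / 25 : ℝ) * (hs / 5) ^ 2) ^ (3/2 : ℝ)))) +
         5 * (61 * 16 / 9) * (Real.pi / ((7 / 16) * d₀))) := by
  set κ : ℝ := Real.exp (-(1 + Real.eulerMascheroniConstant - Real.log 2)) with hκdef
  have hκ : 0 < κ := Real.exp_pos _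
  set cc : ℝ := c j with hcc
  set S : Set ℂ := {z : ℂ | |z.im| < hs ∧ |z.re - cc| < L + hs} with hS
  set Q : Set ℂ := {z : ℂ | |z.im| < hs / 4 ∧ |z.re - cc| < L + hs / 4} with hQ
  have hQS : Q ⊆ S := fun z hz => ⟨by linarith [hz.1], by linarith [hz.2]⟩
  -- derived data
  have hX1 : ∀ k, ContDiff ℝ 1 (X k) := fun k => (hXc k).of_le (by norm_num)
  have hXd : ∀ k, Differentiable ℝ (X k) := fun k => (hX1 k).differentiable (by simp)
  have hosc2 : ∀ k τ σ, ‖deriv (X k) τ - deriv (X k) σ‖ ≤ 1 / 2 := fun k τ σ => (hosc k τ σ).trans hRb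
  have hAc : ∀ k, Continuous (Aa k) := fun k => (hAd k).continuous
  have hA0 : ∀ k σ, 0 ≤ Aa k σ := fun k σ => le_trans (by positivity) (hAfloor k σ)
  have hunit := StadiumBilinearUnitSpeed.sum_sq_deriv_eq_one_on_stadium hhs hL hF hFX (hXd j) (hXu j)
  have hGre : ∀ w ∈ S, Λ⁻¹ / 2 ≤ (G w).re := fun w hw => le_trans (by linarith [hAfloor j w.re]) (hGA w hw)
  have hg₀ : 0 < Λ⁻¹ / 2 := by positivity
  -- the pieces
  let Kc : ℂ → ℂ → (Fin 3 → ℂ) := fun z ζ => (((∑ i, (F z i - F ζ i) ^ 2) + (κ : ℂ) * G ζ) ^ ((3:ℂ) / 2))⁻¹ •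
      (deriv F ζ ⨯₃ (fun i => F z i - F ζ i))
  let Kr : ℂ → ℝ → (Fin 3 → ℂ) := fun z σ => (((∑ i, (F z i - ((X j σ i : ℝ) : ℂ)) ^ 2) + ((κ * Aa j σ : ℝ) : ℂ)) ^ ((3:ℂ) / 2))⁻¹ •
      ((fun i => ((deriv (X j) σ i : ℝ) : ℂ)) ⨯₃ (fun i => F z i - ((X j σ i : ℝ) : ℂ)))
  let V : ℂ → ℕ → ℂ := fun z k => if k = 0 then ((z.re - hs / 2 : ℝ) : ℂ) else if k = 1 then z - ((hs / 5 : ℝ) : ℂ)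
      else if k = 2 then z else if k = 3 then z + ((hs / 5 : ℝ) : ℂ) else ((z.re + hs / 2 : ℝ) : ℂ)
  have hKc : ∀ z ζ, Kc z ζ = (((∑ i, (F z i - F ζ i) ^ 2) + (κ : ℂ) * G ζ) ^ ((3:ℂ) / 2))⁻¹ •
      (deriv F ζ ⨯₃ (fun i => F z i - F ζ i)) := fun _ _ => rfl
  have hKr : ∀ z σ, Kr z σ = (((∑ i, (F z i - ((X j σ i : ℝ) : ℂ)) ^ 2) + ((κ * Aa j σ : ℝ) : ℂ)) ^ ((3:ℂ) / 2))⁻¹ •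
      ((fun i => ((deriv (X j) σ i : ℝ) : ℂ)) ⨯₃ (fun i => F z i - ((X j σ i : ℝ) : ℂ))) := fun _ _ => rfl
  have hV0 : ∀ z, V z 0 = ((z.re - hs / 2 : ℝ) : ℂ) := fun z => by simp [V]
  have hV1 : ∀ z, V z 1 = z - ((hs / 5 : ℝ) : ℂ) := fun z => by simp [V]
  have hV2 : ∀ z, V z 2 = z := fun z => by simp [V]
  have hV3 : ∀ z, V z 3 = z + ((hs / 5 : ℝ) : ℂ) := fun z => by simp [V]
  have hV4 : ∀ z, V z 4 = ((z.re + hs / 2 : ℝ) : ℂ) := fun z => by simp [V]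
  let own : ℂ → (Fin 3 → ℂ) := fun z => (∫ σ in Iic (z.re - hs / 2), Kr z σ) +
      (∑ k ∈ range 4, ∫ t in (0:ℝ)..1, (V z (k+1) - V z k) • Kc z (V z k + (t : ℂ) * (V z (k+1) - V z k))) +
      ∫ σ in Ioi (z.re + hs / 2), Kr z σ
  let partner : Fin N → ℂ → (Fin 3 → ℂ) := fun k z => ∫ σ : ℝ,
      (((∑ i, (F z i - ((X k σ i : ℝ) : ℂ)) ^ 2) + ((κ * Aa k σ : ℝ) : ℂ)) ^ ((3:ℂ) / 2))⁻¹ •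
        ((fun i => ((deriv (X k) σ i : ℝ) : ℂ)) ⨯₃ (fun i => F z i - ((X k σ i : ℝ) : ℂ)))
  let piece : Fin N → ℂ → (Fin 3 → ℂ) := fun k z => if k = j then own z else partner k z
  refine ⟨fun z => ∑ k, (((Γ * γ k / (4 * Real.pi) : ℝ)) : ℂ) • piece k z, ?_, ?_, ?_⟩
  · -- holomorphy
    apply DifferentiableOn.fun_sum
    intro k _
    apply DifferentiableOn.fun_const_smul
    by_cases hk : k = j
    · have hown := tent_differentiableOn hF hM hunit (hX1 j) (hXu j) hRb0 hRb (hosc j) hFX hG hGX (hAc j) (hA0 j) hκ hg₀ hGre hhs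
        hKc hKr hV0 hV1 hV2 hV3 hV4
      refine (hown.congr fun z _ => ?_)
      simp only [piece, if_pos hk]
      rfl
    · have hp := partnerPiece_differentiableOn (hs' := hs / 4) hF hM (hXd j) (hXu j) hFX (hX1 k) (hXu k) (hosc2 k) (hAc k) (hA0 k) hκ.le hd₀
        (hsep k hk) (by linarith) h16d
      refine ((hp.mono fun z hz => ⟨hz.1, by linarith [hz.2]⟩).congr fun z _ => ?_)
      simp only [piece, if_neg hk]
      rfl
  · -- real agreement
    intro t ht
    have htQ : |t - cc| < L + hs / 4 := by have := ht.2; simp at this; linarith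
    have htS : |t - cc| < L + hs := by linarith
    have hcplx := cplx_u_eq (X := X) hu j t
    rw [hcplx]
    refine Finset.sum_congr rfl fun k _ => ?_
    congr 1
    by_cases hk : k = j
    · subst hk
      simp only [piece, if_true]
      have hown := tent_real hF (hX1 k) (hXu k) (hosc2 k) hFX (hAc k) hΛ (hAfloor k) hGX hhs hκ hKc hKr hV0 hV1 hV2 hV3 hV4
        (t := t) (by linarith)
      have einner : (fun i => ((⟪∫ σ : ℝ, ((‖X k t - X k σ‖ ^ 2 + κ * Aa k σ) ^ (3/2 : ℝ))⁻¹ • cross (deriv (X k) σ) (X k t - X k σ),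
          EuclideanSpace.single i (1:ℝ)⟫_ℝ : ℝ) : ℂ)) =
          fun i => (((∫ σ : ℝ, ((‖X k t - X k σ‖ ^ 2 + κ * Aa k σ) ^ (3/2 : ℝ))⁻¹ • cross (deriv (X k) σ) (X k t - X k σ)) i : ℝ) : ℂ) := by
        funext i; rw [Summit.NavierStokesRegularity.NavierStokesRegularity.Theorems.StadiumDeviationPackage.inner_single_eq]
      rw [einner, ← hown]
    · simp only [piece, if_neg hk]
      have einner : (fun i => ((⟪∫ σ : ℝ, ((‖X j t - X k σ‖ ^ 2 + κ * Aa k σ) ^ (3/2 : ℝ))⁻¹ • cross (deriv (X k) σ) (X j t - X k σ),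
          EuclideanSpace.single i (1:ℝ)⟫_ℝ : ℝ) : ℂ)) =
          fun i => (((∫ σ : ℝ, ((‖X j t - X k σ‖ ^ 2 + κ * Aa k σ) ^ (3/2 : ℝ))⁻¹ • cross (deriv (X k) σ) (X j t - X k σ)) i : ℝ) : ℂ) := by
        funext i; rw [Summit.NavierStokesRegularity.NavierStokesRegularity.Theorems.StadiumDeviationPackage.inner_single_eq]
      rw [einner]
      exact partnerPiece_real hFX (hX1 k) (hXu k) (hosc2 k) (hAc k) (hA0 k) hκ.le hd₀ (hsep k hk) hhs htS
  · -- the bound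
    intro z hz
    have hown := own_tent_norm_le hF hM hunit (hX1 j) (hXu j) hRb0 hRb (hosc j) hFX (hAc j) (hA0 j) hGre hκ hΛ hhs hR
      hKc hKr hV0 hV1 hV2 hV3 hV4 hz.1 hz.2
    have hpart : ∀ k, k ≠ j → ‖partner k z‖ ≤ 5 * (61 * 16 / 9) * (Real.pi / ((7 / 16) * d₀)) := fun k hk =>
      partnerPiece_norm_le (hs' := hs / 4) hF hM (hXd j) (hXu j) hFX (hXd k) (hXu k) (hosc2 k) (hA0 k) hκ.le hd₀ (hsep k hk) (by linarith) h16d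
        ⟨hz.1, by linarith [hz.2]⟩
    set Bown : ℝ := (2 * (160 * (Real.pi / (1 * (hs / 2)))) + 2 * (((0.007 * hs) ^ 2) ^ (-(3/2 : ℝ)) * (8 * hs) * hs) +
          2 * (4 * (2 * ((2 / (hs / 2)) * (hs / 5) ^ 3)) *
            ((1/3 + Real.log ((1 - 0) * √((21 / 25 : ℝ) * (hs / 5) ^ 2) / √(κ / (2 * Λ)))) / ((21 / 25 : ℝ) * (hs / 5) ^ 2) ^ (3/2 : ℝ))))
      with hBown
    set Bpart : ℝ := 5 * (61 * 16 / 9) * (Real.pi / ((7 / 16) * d₀)) with hBpart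
    have hBown0 : 0 ≤ Bown := (norm_nonneg _).trans hown
    have hBpart0 : 0 ≤ Bpart := by rw [hBpart]; positivity
    have hpiece : ∀ k, ‖piece k z‖ ≤ Bown + Bpart := by
      intro k
      by_cases hk : k = j
      · simp only [piece, if_pos hk]
        exact hown.trans (by linarith)
      · simp only [piece, if_neg hk]
        exact (hpart k hk).trans (by linarith)
    calc ‖∑ k, (((Γ * γ k / (4 * Real.pi) : ℝ)) : ℂ) • piece k z‖
        ≤ ∑ k, ‖(((Γ * γ k / (4 * Real.pi) : ℝ)) : ℂ) • piece k z‖ := norm_sum_le _ _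
      _ ≤ ∑ k, |Γ * γ k / (4 * Real.pi)| * (Bown + Bpart) := Finset.sum_le_sum fun k _ => by
          rw [norm_smul, Complex.norm_real, Real.norm_eq_abs]
          exact mul_le_mul_of_nonneg_left (hpiece k) (abs_nonneg _)
      _ = (∑ k, |Γ * γ k / (4 * Real.pi)|) * (Bown + Bpart) := by rw [Finset.sum_mul]

end Summit.NavierStokesRegularity.NavierStokesRegularity.Theorems.StadiumQuarterCore

end
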